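import Literature.Combinatorics.SimpleGraph.LaplacianMaximumPrinciple
import HarnessLib

/-!
# Least action and the monovariant `b_q`: the `q`-reduced divisor is reached from every
# `E ∈ |D|_q` by firing alone, and it is the unique minimiser of `b_q` and of the energy `ℰ_q`
# on `|D|_q` (Baker–Shokrieh 2013, Lemma 14 (a), Propositions 8 and 11, Theorems 15 and 17)

Source (held, read at the page; statements VERBATIM). M. Baker, F. Shokrieh, *Chip-firing games,
potential theory on graphs, and spanning trees*, J. Combin. Theory Ser. A 120 (2013) 164–182
[BakerShokrieh2013] (held text `paper:arxiv-1107.1313`, chunks p0008–p0009), with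
`|D|_q = {E ∈ Div(G) : E ∼ D, E(v) ≥ 0 for all v ≠ q}` and `b_q(D) = ⟨𝟏, D⟩_q`:
«**Proposition 11.** (a) If `E = D + Δ(f) ∈ Div(G)` for some `f ∈ ℳ(G)`, then
`b_q(E) = b_q(D) + Σ_{v ∈ V(G)} (f(v) − f(q))`. (b) If `E = D − Δ(χ_A) ∈ Div(G)` for some
`A ⊆ V(G)∖{q}`, then `b_q(E) = b_q(D) − |A|`. Thus `b_q(·)` is a monovariant.» «**Proposition 8.**
(a) If `E = D + Δ(f) ∈ Div(G)` for some `f ∈ ℳ(G)`, then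
`ℰ_q(E) = ℰ_q(D) + Σ_{v ∈ V(G)} (D + E)(v)·f(v) − 2 deg(E)·f(q)`. (b) If `E = D − Δ(χ_A) ∈ Div(G)`
for some `A ⊆ V(G)∖{q}`, then `ℰ_q(E) = ℰ_q(D) − Σ_{v ∈ A} (D + E)(v)`. If, moreover, `E` is
effective on `A` […], then `ℰ_q(E) ≤ ℰ_q(D) − λ(A)`.» «**Theorem 15.** Fix `q ∈ V(G)` and let
`D ∈ Div(G)`. Then `D` is `q`-reduced if and only if `D ∈ |D|_q` and `ℰ_q(D) < ℰ_q(D′)` for all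
`D′ ≠ D` in `|D|_q`.» «**Lemma 14
(Principle of least action).** Let `D` be a `q`-reduced divisor. Assume `E ∼ D` and write
`D = E + Δ(f)`. (a) If `E ∈ |D|_q`, then `f(v) ≤ f(q)` for all `v ∈ V(G)`.» «**Theorem 17.** Fix
`q ∈ V(G)` and let `D ∈ Div(G)`. Then `D` is `q`-reduced if and only if `D ∈ |D|_q` and
`b_q(D) < b_q(D′)` for all `D′ ≠ D` in `|D|_q`. *Proof.* […] If `D` is `q`-reduced, then
`D ∈ |D|_q` by definition. Let `E ∈ |D|_q` be another divisor. Write `D = E + Δ(f)` with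
`f(q) = 0`. By Lemma 14 (a) we have `f(v) ≤ 0`. Now, by Proposition 11 (a), we have
`b_q(D) = b_q(E) + Σ_{v ≠ q} f(v) ≤ b_q(E)`. […] assume `D ∈ |D|_q` and `b_q(D) ≤ b_q(E)` for all
`E ∈ |D|_q` but `D` is not `q`-reduced. Then there exists a non-empty set `A ⊆ V(G)∖{q}` such that
`D₁ = D − Δ(χ_A) ∈ |D|_q`, so Proposition 11 (b) implies `b_q(D₁) = b_q(D) − |A|`» (a
contradiction). The graphs of the source are connected.

## What is formalised (vocabulary: `IsReduced G q D`, `LinEquiv`, `charFun` of `ReducedDivisors`;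
## `Δ(f) = G.lapMatrix ℤ *ᵥ f`)

By Proposition 11 (a), within one linear equivalence class `b_q` is determined up to an additive
constant by `b_q(D + Δ(f)) − b_q(D) = Σ_v (f(v) − f(q))`; Theorem 17 only compares `b_q` inside
`|D|_q`, so it is stated here through these increments (no generalised inverse is needed):
* **Lemma 14 (a) as reachability by firing alone**: `IsReduced.exists_nonneg_script` — for a
  `q`-reduced `D` and `E ∈ |D|_q` there is `f ≥ 0` with `f(q) = 0` and `D = E − Δ(f)` (the
  reduced divisor is obtained from `E` by firing vertices other than `q`, never borrowing);
* Proposition 11 (b)'s count `sum_charFun_sub_apply_base` (`Σ_v (χ_A(v) − χ_A(q)) = |A|` for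
  `q ∉ A`);
* **Theorem 17** `isReduced_iff_forall_script_sum_pos`: `D` is `q`-reduced iff `D ∈ |D|_q` and
  every other `E = D + Δ(f) ∈ |D|_q` has `b_q(E) − b_q(D) = Σ_v (f(v) − f(q)) > 0`;
* **Theorem 15** (energy version) `isReduced_iff_forall_script_energy_pos`, through the increments
  `ℰ_q(E) − ℰ_q(D) = Σ_v (D + E)(v)(f(v) − f(q))` of Proposition 8 (a), and Proposition 8 (b)'s
  estimate `cut_le_sum_add_of_nonneg`.

Theorems only; no `sorry`; no named facts.
-/

open Finset SimpleGraph Matrix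
open Literature.Combinatorics.SimpleGraph.ChipFiring

namespace Literature.Combinatorics.SimpleGraph.BakerNorine

variable {V : Type*} [Fintype V] [DecidableEq V] {G : SimpleGraph V} [DecidableRel G.Adj]

/-- **Lemma 14 (a), as reachability by firing alone.** If `D` is `q`-reduced and `E ∈ |D|_q`
(`E ∼ D`, `E ≥ 0` off `q`), then `D = E − Δ(f)` for a script `f ≥ 0` with `f(q) = 0`: the reduced
divisor is obtained from `E` by firing vertices other than `q` («`D = E + Δ(f)` […] `f(v) ≤ f(q)`»,
normalised at `q`). [cite: BakerShokrieh2013, Lemma 14 (a)] -/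
theorem IsReduced.exists_nonneg_script {q : V} {D E : V → ℤ} (hD : IsReduced G q D)
    (hDE : LinEquiv G D E) (hE : ∀ v, v ≠ q → 0 ≤ E v) :
    ∃ f : V → ℤ, 0 ≤ f ∧ f q = 0 ∧ D = E - G.lapMatrix ℤ *ᵥ f := by
  obtain ⟨g, hg⟩ := (linEquiv_iff_exists_eq_sub G D E).1 hDE
  -- `E = D − Δ(g)` with `g ≤ g(q)`; take `f = g(q) − g`
  have hle : ∀ w, g w ≤ g q := hD.apply_le_apply_base (f := g) (fun v hv => by rw [← hg]; exact hE v hv)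
  refine ⟨fun v => g q - g v, fun v => by simp only [Pi.zero_apply]; linarith [hle v], by simp, ?_⟩
  have hconst : G.lapMatrix ℤ *ᵥ (fun _ : V => g q) = 0 := by
    funext v
    rw [lapMatrix_mulVec_apply_eq_sum_sub, Pi.zero_apply]
    exact Finset.sum_eq_zero fun w _ => sub_self _
  have hsplit : (fun v => g q - g v) = (fun _ : V => g q) - g := by funext v; simp
  rw [hsplit, Matrix.mulVec_sub, hconst, zero_sub, sub_neg_eq_add, hg, sub_add_cancel]

/-- Proposition 11 (b)'s count: firing the set `A ∌ q` changes `Σ_v (f(v) − f(q))` by `|A|`: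
`Σ_v (χ_A(v) − χ_A(q)) = |A|`. [cite: BakerShokrieh2013, Proposition 11 (b)] -/
theorem sum_charFun_sub_apply_base {q : V} {A : Finset V} (hq : q ∉ A) :
    ∑ v, (charFun A v - charFun A q) = #A := by
  simp only [charFun_apply, if_neg hq, sub_zero]
  rw [Finset.sum_boole, Finset.filter_mem_eq_inter, Finset.univ_inter]

/-- **Theorem 17** (with Proposition 11 (a): `b_q(D + Δ(f)) − b_q(D) = Σ_v (f(v) − f(q))`).
«`D` is `q`-reduced if and only if `D ∈ |D|_q` and `b_q(D) < b_q(D′)` for all `D′ ≠ D` in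
`|D|_q`»: `D` is `q`-reduced iff `D ≥ 0` off `q` and every `E = D + Δ(f) ≠ D` that is `≥ 0` off
`q` has `Σ_v (f(v) − f(q)) > 0` (`G` connected). [cite: BakerShokrieh2013, Theorem 17] -/
theorem isReduced_iff_forall_script_sum_pos (hG : G.Connected) (q : V) (D : V → ℤ) :
    IsReduced G q D ↔ (∀ v, v ≠ q → 0 ≤ D v) ∧
      ∀ f : V → ℤ, (∀ v, v ≠ q → 0 ≤ (D + G.lapMatrix ℤ *ᵥ f) v) →
        D + G.lapMatrix ℤ *ᵥ f ≠ D → 0 < ∑ v, (f v - f q) := by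
  constructor
  · intro hD
    refine ⟨fun v hv => hD.nonneg hv, fun f hE hne => ?_⟩
    -- least action: `f(q) ≤ f(v)` for all `v`
    have hle : ∀ w, (-f) w ≤ (-f) q := hD.apply_le_apply_base (f := -f) fun v hv => by
      rw [Matrix.mulVec_neg, sub_neg_eq_add]; exact hE v hv
    simp only [Pi.neg_apply, neg_le_neg_iff] at hle
    -- and `f` is not constant, since `Δ(f) ≠ 0`
    have hnc : ∃ x y, f x ≠ f y := by
      by_contra hall
      push Not at hall
      apply hne
      rw [(lapMatrix_mulVec_eq_zero_iff_forall_eq hG f).2 hall, add_zero]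
    obtain ⟨x, y, hxy⟩ := hnc
    have hlt : ∃ w, f q < f w := by
      by_contra hall
      push Not at hall
      exact hxy ((le_antisymm (hall x) (hle x)).trans (le_antisymm (hall y) (hle y)).symm)
    obtain ⟨w, hw⟩ := hlt
    have h1 : ∀ v ∈ (univ : Finset V), 0 ≤ f v - f q := fun v _ => by linarith [hle v]
    have h2 : 0 < f w - f q := by linarith
    exact lt_of_lt_of_le h2 (Finset.single_le_sum h1 (mem_univ w))
  · rintro ⟨h0, hmin⟩
    refine isReduced_of_forall_exists_neg G h0 fun A hA hqA => ?_
    by_contra hno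
    push Not at hno
    -- firing `A` keeps every vertex `≠ q` out of debt …
    have hE : ∀ v, v ≠ q → 0 ≤ (D + G.lapMatrix ℤ *ᵥ (-charFun A)) v := fun v hv => by
      rw [Matrix.mulVec_neg, ← sub_eq_add_neg]
      by_cases hvA : v ∈ A
      · exact hno v hvA
      · exact (h0 v hv).trans (le_sub_mulVec_charFun_apply_of_not_mem G D hvA)
    -- … and changes the divisor (some vertex of `A` has a neighbour outside `A`, by connectivity)
    have hne : D + G.lapMatrix ℤ *ᵥ (-charFun A) ≠ D := by
      intro h
      have h0' : G.lapMatrix ℤ *ᵥ charFun A = 0 := by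
        rw [Matrix.mulVec_neg] at h
        have := congrArg (fun x => x - D) h
        simpa using this
      have hconst := (lapMatrix_mulVec_eq_zero_iff_forall_eq hG (charFun A)).1 h0'
      obtain ⟨a, ha⟩ := hA
      have h1 := hconst a q
      rw [charFun_apply, charFun_apply, if_pos ha, if_neg hqA] at h1
      exact one_ne_zero h1
    have h := hmin (-charFun A) hE hne
    simp only [Pi.neg_apply] at h
    have h' : ∑ v, (-charFun A v - -charFun A q) = -∑ v, (charFun A v - charFun A q) := by
      rw [← Finset.sum_neg_distrib]
      exact Finset.sum_congr rfl fun v _ => by ring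
    rw [h', sum_charFun_sub_apply_base hqA] at h
    have : (0 : ℤ) ≤ #A := Nat.cast_nonneg _
    linarith

/-! ### Theorem 15: the energy version -/

section Energy

/-- Proposition 8 (b)'s estimate: if `E = D − Δ(χ_A)` is effective on `A`, then
`Σ_{v ∈ A} (D + E)(v) ≥ λ(A)`, the size of the `(A, V∖A)`-cut («`D(v) ≥ outdeg_A(v)` for `v ∈ A`.
So `Σ_{v∈A} (D+E)(v) ≥ Σ_{v∈A} outdeg_A(v) = λ(A)`»). [cite: BakerShokrieh2013, Proposition 8 (b)] -/
theorem cut_le_sum_add_of_nonneg {A : Finset V} {D : V → ℤ}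
    (hE : ∀ v ∈ A, 0 ≤ (D - G.lapMatrix ℤ *ᵥ charFun A) v) :
    (∑ v ∈ A, (#(G.neighborFinset v \ A) : ℤ)) ≤
      ∑ v ∈ A, (D + (D - G.lapMatrix ℤ *ᵥ charFun A)) v := by
  refine Finset.sum_le_sum fun v hv => ?_
  have h1 := hE v hv
  have h2 := sub_mulVec_charFun_apply_of_mem G D hv
  rw [Pi.add_apply]
  omega

/-- **Theorem 15** (with Proposition 8 (a): `ℰ_q(D + Δ(f)) − ℰ_q(D) = Σ_v (D + E)(v)·f(v) −
2 deg(E)·f(q) = Σ_v (D + E)(v)(f(v) − f(q))`). «`D` is `q`-reduced if and only if `D ∈ |D|_q` and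
`ℰ_q(D) < ℰ_q(D′)` for all `D′ ≠ D` in `|D|_q`»: stated through the energy increments inside the
class (`G` connected). [cite: BakerShokrieh2013, Theorem 15] -/
theorem isReduced_iff_forall_script_energy_pos (hG : G.Connected) (q : V) (D : V → ℤ) :
    IsReduced G q D ↔ (∀ v, v ≠ q → 0 ≤ D v) ∧
      ∀ f : V → ℤ, (∀ v, v ≠ q → 0 ≤ (D + G.lapMatrix ℤ *ᵥ f) v) →
        D + G.lapMatrix ℤ *ᵥ f ≠ D →
          0 < ∑ v, (D + (D + G.lapMatrix ℤ *ᵥ f)) v * (f v - f q) := by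
  constructor
  · intro hD
    refine ⟨fun v hv => hD.nonneg hv, fun f hE hne => ?_⟩
    -- least action: `f(q) ≤ f(v)` for all `v`
    have hle : ∀ w, (-f) w ≤ (-f) q := hD.apply_le_apply_base (f := -f) fun v hv => by
      rw [Matrix.mulVec_neg, sub_neg_eq_add]; exact hE v hv
    simp only [Pi.neg_apply, neg_le_neg_iff] at hle
    -- `f` is not constant; at a maximum vertex `w` with `Δ_w(f) > 0` the term is positive
    have hnc : ∃ x y, f x ≠ f y := by
      by_contra hall
      push Not at hall
      apply hne
      rw [(lapMatrix_mulVec_eq_zero_iff_forall_eq hG f).2 hall, add_zero]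
    obtain ⟨w, hwmax, hwpos⟩ := exists_max_lapMatrix_mulVec_pos hG hnc
    have hwq : f q < f w := by
      rcases (hle w).eq_or_lt with h | h
      · exfalso
        obtain ⟨x, y, hxy⟩ := hnc
        have hx := le_antisymm (h ▸ hwmax x) (hle x)
        have hy := le_antisymm (h ▸ hwmax y) (hle y)
        exact hxy (hx.trans hy.symm)
      · exact h
    have hwne : w ≠ q := fun h => by rw [h] at hwq; exact lt_irrefl _ hwq
    have hterm : ∀ v ∈ (univ : Finset V), 0 ≤ (D + (D + G.lapMatrix ℤ *ᵥ f)) v * (f v - f q) := by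
      intro v _
      by_cases hv : v = q
      · rw [hv, sub_self, mul_zero]
      · refine mul_nonneg ?_ (by linarith [hle v])
        rw [Pi.add_apply]
        exact add_nonneg (hD.nonneg hv) (hE v hv)
    refine lt_of_lt_of_le ?_ (Finset.single_le_sum hterm (mem_univ w))
    refine mul_pos ?_ (by linarith)
    rw [Pi.add_apply, Pi.add_apply]
    have := hD.nonneg hwne
    linarith
  · rintro ⟨h0, hmin⟩
    refine isReduced_of_forall_exists_neg G h0 fun A hA hqA => ?_
    by_contra hno
    push Not at hno
    have hE : ∀ v, v ≠ q → 0 ≤ (D + G.lapMatrix ℤ *ᵥ (-charFun A)) v := fun v hv => by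
      rw [Matrix.mulVec_neg, ← sub_eq_add_neg]
      by_cases hvA : v ∈ A
      · exact hno v hvA
      · exact (h0 v hv).trans (le_sub_mulVec_charFun_apply_of_not_mem G D hvA)
    have hne : D + G.lapMatrix ℤ *ᵥ (-charFun A) ≠ D := by
      intro h
      have h0' : G.lapMatrix ℤ *ᵥ charFun A = 0 := by
        rw [Matrix.mulVec_neg] at h
        have := congrArg (fun x => x - D) h
        simpa using this
      have hconst := (lapMatrix_mulVec_eq_zero_iff_forall_eq hG (charFun A)).1 h0'
      obtain ⟨a, ha⟩ := hA
      have h1 := hconst a q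
      rw [charFun_apply, charFun_apply, if_pos ha, if_neg hqA] at h1
      exact one_ne_zero h1
    have h := hmin (-charFun A) hE hne
    -- but every term of the energy increment is `≤ 0`: it is `−(D + E)(v)` on `A` and `0` off `A`
    have hle : ∑ v, (D + (D + G.lapMatrix ℤ *ᵥ (-charFun A))) v * ((-charFun A) v - (-charFun A) q)
        ≤ 0 := by
      refine Finset.sum_nonpos fun v _ => ?_
      simp only [Pi.neg_apply, charFun_apply, if_neg hqA, neg_zero, sub_zero]
      by_cases hvA : v ∈ A
      · rw [if_pos hvA]
        have hvq : v ≠ q := fun h => hqA (h ▸ hvA)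
        have h1 := h0 v hvq
        have h2 := hE v hvq
        rw [Pi.add_apply]
        nlinarith
      · rw [if_neg hvA, neg_zero, mul_zero]
    linarith

end Energy

end Literature.Combinatorics.SimpleGraph.BakerNorine
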